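/-
Copyright: the m5 harness (cell B2b-5 `b2b-lgcu-borel`, generation 21).  Sorry-free; axioms: propext,
Classical.choice, Quot.sound.  VALUE = THEOREM (a budget-free, TPP-free exclusion on the level-one
slice), NOT summit progress: the crux `SubgroupIdentityDesigns` is untouched.
-/
import Mathlib
import Summits.MatrixMultiplication.MatrixMultiplication.Theorems.SubgroupIdentityDesigns.Negative.AdmissibilityPrinciple

/-!
# No member of a level-one witness contains a corner group of order `p³`

An instance of the ADMISSIBILITY PRINCIPLE (`AdmissibilityPrinciple.false_of_cover`) on the
UNIPOTENT side.  Fix an embedding `e : Fin 4 ↪ Fin m` (four distinct coordinates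
`i₀ = e 0, i₁ = e 1, i₂ = e 2, i₃ = e 3`; so `m ≥ 4`) and let

  `X(a, b, c) = a E_{i₀ i₂} + b E_{i₀ i₃} + c E_{i₁ i₂}`,  `K_e = {1 + X(a, b, c) : a, b, c ∈ 𝔽_p}`.

`K_e` is an elementary abelian subgroup of `GL_m(𝔽_p)` of order `p³` (`X X' = 0` since the rows
`{i₀, i₁}` and columns `{i₂, i₃}` are disjoint): a hyperplane in the `2 × 2` corner
`Hom(⟨e_{i₂}, e_{i₃}⟩, ⟨e_{i₀}, e_{i₁}⟩)`.  Its linear character `σ(1 + X(a,b,c)) = ψ(b + c)`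
(`ψ` the standard additive character of `𝔽_p`) has NO admissible vector: every `w ∈ 𝔽_p^m` is
fixed by an element of `K_e` on which `σ ≠ 1` —

* if `w_{i₂} ≠ 0`: by `1 + X(−w_{i₃}/w_{i₂}, 1, 0)` (`σ = ψ(1)`),
* if `w_{i₂} = 0`: by `1 + X(0, 0, 1)` (`σ = ψ(1)`).

Hence (`false_of_cover`) `K_e` carries no level-one delta, and therefore

  **no member `H₁, H₂, H₃` of a subgroup-TPP triple carrying a level-one identity design contains
  `K_e`** (`corner_not_le_member`) — for EVERY prime `p`, every `m ≥ 4`, every position and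
  every exponent `ε` (the design's character budget is not used, nor is the TPP).

Remarks.  (1) `|K_e| = p³ ≤ b = (p^m − 1)/(p − 1)` for `m ≥ 4`, far inside every order window, so
this is invisible to all counting laws (N1/N2, pair walls, semiregular and character laws).
(2) Carrying a delta depends on the EMBEDDING, not on the isomorphism type: the translation group
`A ≅ 𝔽_p^{m−1}` (all transvections with a common axis) has regular orbits and does carry one.
(3) Exhaustive data at `(p, m) = (3, 4)` (`code/g21/corner_check.py`): of the 211 subgroups
`{1 + X : X ∈ W}`, `W` a subspace of the `2 × 2` corner, exactly those with `dim W ≥ 3` (41) carry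
no delta; the Heisenberg block `U₃ ⊕ 1` and the `2 × 2` block-unipotent group carry none either.
-/

noncomputable section

open scoped BigOperators Classical Matrix

namespace Summit.MatrixMultiplication.MatrixMultiplication.Theorems.SubgroupIdentityDesigns.Negative
namespace CornerGroupExclusion

open Literature.Barriers.MatrixMultiplication (SubgroupTPP)
open Summit.MatrixMultiplication.MatrixMultiplication.Theorems.LieRankDesigns.Negative (GLm Mat)
open Summit.MatrixMultiplication.MatrixMultiplication.Theorems.LevelOneGL2Designs.Negative
open PackingBridge (exists_test)
open AdmissibilityPrinciple (false_of_cover vanish_of_le)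

variable {p m : ℕ} [hp : Fact p.Prime]

/-- The parameter group `𝔽_p³` (entries `a = t.1`, `b = t.2.1`, `c = t.2.2`). -/
abbrev Param (p : ℕ) := ZMod p × ZMod p × ZMod p

section Nil

variable (e : Fin 4 ↪ Fin m)

/-- The corner nilpotent `X(a,b,c) = a E_{i₀ i₂} + b E_{i₀ i₃} + c E_{i₁ i₂}`. -/
def nil (t : Param p) : Mat p m := fun i j =>
  (if i = e 0 then 1 else 0) * ((if j = e 2 then t.1 else 0) + (if j = e 3 then t.2.1 else 0)) +
    (if i = e 1 then 1 else 0) * (if j = e 2 then t.2.2 else 0)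

/-- `X` is additive in the parameters. -/
theorem nil_add (s t : Param p) : nil e s + nil e t = nil e (s + t) := by
  ext i j
  simp only [nil, Matrix.add_apply, Prod.fst_add, Prod.snd_add]
  split_ifs <;> ring

/-- `X(0) = 0`. -/
theorem nil_zero : nil e (0 : Param p) = 0 := by
  ext i j
  simp [nil]

/-- `X(s) X(t) = 0`: the rows `{i₀, i₁}` and the columns `{i₂, i₃}` of the corner are disjoint. -/
theorem nil_mul (s t : Param p) : nil e s * nil e t = 0 := by
  ext i j
  rw [Matrix.mul_apply, Matrix.zero_apply]
  refine Finset.sum_eq_zero fun k _ => ?_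
  have h20 : e 2 ≠ e 0 := fun h => by simpa using e.injective h
  have h21 : e 2 ≠ e 1 := fun h => by simpa using e.injective h
  have h30 : e 3 ≠ e 0 := fun h => by simpa using e.injective h
  have h31 : e 3 ≠ e 1 := fun h => by simpa using e.injective h
  by_cases hk2 : k = e 2
  · subst hk2; simp [nil, h20, h21]
  by_cases hk3 : k = e 3
  · subst hk3; simp [nil, h30, h31]
  simp [nil, hk2, hk3]

/-- `(1 + X(s))(1 + X(t)) = 1 + X(s + t)`. -/
theorem one_add_nil_mul (s t : Param p) :
    (1 + nil e s) * (1 + nil e t) = 1 + nil e (s + t) := by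
  rw [add_mul, one_mul, mul_add, mul_one, nil_mul, add_zero, add_assoc, nil_add, add_comm t s]

/-- The action of `X(t)` on a vector: `(X w)_{i₀} = a w_{i₂} + b w_{i₃}`, `(X w)_{i₁} = c w_{i₂}`. -/
theorem nil_mulVec (t : Param p) (w : Fin m → ZMod p) :
    nil e t *ᵥ w = Pi.single (e 0) (t.1 * w (e 2) + t.2.1 * w (e 3)) +
      Pi.single (e 1) (t.2.2 * w (e 2)) := by
  funext i
  simp only [Matrix.mulVec, dotProduct, nil, Pi.add_apply]
  simp only [add_mul, Finset.sum_add_distrib, mul_assoc, ite_mul, zero_mul]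
  simp only [mul_add, mul_ite, mul_zero]
  by_cases h0 : i = e 0
  · have h1 : i ≠ e 1 := fun h => by
      have := e.injective (h0.symm.trans h); simp at this
    subst h0
    simp [h1, Finset.sum_add_distrib, Finset.sum_ite_eq']
  · by_cases h1 : i = e 1
    · subst h1
      simp [h0, Finset.sum_ite_eq']
    · simp [h0, h1]

/-- Entry `(i₀, i₂)` of `X(t)` is `a`. -/
theorem nil_apply_02 (t : Param p) : nil e t (e 0) (e 2) = t.1 := by
  have h32 : e 2 ≠ e 3 := fun h => by simpa using e.injective h
  have h01 : e 0 ≠ e 1 := fun h => by simpa using e.injective h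
  simp [nil, h32, h01]

/-- Entry `(i₀, i₃)` of `X(t)` is `b`. -/
theorem nil_apply_03 (t : Param p) : nil e t (e 0) (e 3) = t.2.1 := by
  have h32 : e 3 ≠ e 2 := fun h => by simpa using e.injective h
  have h01 : e 0 ≠ e 1 := fun h => by simpa using e.injective h
  simp [nil, h32, h01]

/-- Entry `(i₁, i₂)` of `X(t)` is `c`. -/
theorem nil_apply_12 (t : Param p) : nil e t (e 1) (e 2) = t.2.2 := by
  have h32 : e 2 ≠ e 3 := fun h => by simpa using e.injective h
  have h10 : e 1 ≠ e 0 := fun h => by simpa using e.injective h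
  simp [nil, h32, h10]

end Nil

section Group

variable (e : Fin 4 ↪ Fin m)

/-- The corner element `1 + X(t)` of `GL_m(𝔽_p)` (inverse `1 + X(−t)`). -/
def elt (t : Param p) : GLm p m where
  val := 1 + nil e t
  inv := 1 + nil e (-t)
  val_inv := by rw [one_add_nil_mul, add_neg_cancel, nil_zero, add_zero]
  inv_val := by rw [one_add_nil_mul, neg_add_cancel, nil_zero, add_zero]

/-- Underlying matrix of `elt`. -/
theorem coe_elt (t : Param p) : ((elt e t : GLm p m) : Mat p m) = 1 + nil e t := rfl

/-- The corner group as the image of the homomorphism `𝔽_p³ → GL_m(𝔽_p)`, `t ↦ 1 + X(t)`. -/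
def hom : Multiplicative (Param p) →* GLm p m where
  toFun t := elt e (Multiplicative.toAdd t)
  map_one' := Units.ext (by rw [coe_elt, toAdd_one, nil_zero, add_zero]; rfl)
  map_mul' s t := Units.ext (by
    rw [Units.val_mul, coe_elt, coe_elt, coe_elt, toAdd_mul, one_add_nil_mul])

/-- Value of `hom`. -/
theorem hom_apply (t : Multiplicative (Param p)) :
    ((hom e t : GLm p m) : Mat p m) = 1 + nil e (Multiplicative.toAdd t) := rfl

/-- `hom` is injective (read off the three corner entries). -/
theorem hom_injective : Function.Injective (hom (p := p) e) := by
  intro s t h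
  have h' := congrArg (fun g : GLm p m => (g : Mat p m)) h
  simp only [hom_apply, add_right_inj] at h'
  have h02 := congr_fun (congr_fun h' (e 0)) (e 2)
  have h03 := congr_fun (congr_fun h' (e 0)) (e 3)
  have h12 := congr_fun (congr_fun h' (e 1)) (e 2)
  rw [nil_apply_02, nil_apply_02] at h02
  rw [nil_apply_03, nil_apply_03] at h03
  rw [nil_apply_12, nil_apply_12] at h12
  exact Multiplicative.toAdd.injective (Prod.ext h02 (Prod.ext h03 h12))

/-- **The corner group** `K_e = {1 + a E_{i₀i₂} + b E_{i₀i₃} + c E_{i₁i₂}}` (order `p³`). -/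
abbrev cornerGroup : Subgroup (GLm p m) := (hom (p := p) e).range

/-- The element `1 + X(t)` of `K_e`. -/
def mem (t : Param p) : cornerGroup (p := p) e :=
  ⟨hom e (Multiplicative.ofAdd t), ⟨_, rfl⟩⟩

/-- Underlying matrix of `mem e t`. -/
theorem coe_mem (t : Param p) : (((mem e t : cornerGroup e) : GLm p m) : Mat p m) = 1 + nil e t :=
  rfl

/-- The additive functional `(a, b, c) ↦ b + c` as a homomorphism of multiplicative groups. -/
def bcHom : Multiplicative (Param p) →* Multiplicative (ZMod p) :=
  AddMonoidHom.toMultiplicative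
    (((AddMonoidHom.fst (ZMod p) (ZMod p)).comp (AddMonoidHom.snd (ZMod p) (ZMod p × ZMod p))) +
      ((AddMonoidHom.snd (ZMod p) (ZMod p)).comp (AddMonoidHom.snd (ZMod p) (ZMod p × ZMod p))))

/-- Value of `bcHom`. -/
theorem bcHom_apply (t : Param p) :
    bcHom (Multiplicative.ofAdd t) = Multiplicative.ofAdd (t.2.1 + t.2.2) := rfl

/-- **The bad character** `σ(1 + X(a,b,c)) = ψ(b + c)` of `K_e`. -/
def badChar : cornerGroup (p := p) e →* ℂˣ :=
  ((ZMod.stdAddChar (N := p)).toMonoidHom.comp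
    (bcHom.comp (MonoidHom.ofInjective (hom_injective e)).symm.toMonoidHom)).toHomUnits

/-- Value of the bad character on `1 + X(t)`. -/
theorem badChar_mem (t : Param p) :
    ((badChar e (mem e t) : ℂˣ) : ℂ) = ZMod.stdAddChar (t.2.1 + t.2.2) := by
  have hsymm : (MonoidHom.ofInjective (hom_injective e)).symm (mem e t) =
      Multiplicative.ofAdd t := by
    apply hom_injective e
    rw [MonoidHom.apply_ofInjective_symm]
    rfl
  rw [badChar, MonoidHom.coe_toHomUnits, MonoidHom.comp_apply, AddChar.toMonoidHom_apply,
    MonoidHom.comp_apply, MulEquiv.coe_toMonoidHom, hsymm, bcHom_apply]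
  rfl

/-- `ψ(1) ≠ 1`, so the bad character is `≠ 1` wherever `b + c = 1`. -/
theorem badChar_mem_ne_one {t : Param p} (ht : t.2.1 + t.2.2 = 1) : badChar e (mem e t) ≠ 1 := by
  intro h
  have h' := congrArg (fun u : ℂˣ => (u : ℂ)) h
  simp only [Units.val_one] at h'
  rw [badChar_mem, ht,
    AddChar.IsPrimitive.zmod_char_eq_one_iff p (ZMod.isPrimitive_stdAddChar p)] at h'
  exact one_ne_zero h'

/-- `1 + X(t)` fixes `w` as soon as `a w_{i₂} + b w_{i₃} = 0` and `c w_{i₂} = 0`. -/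
theorem mem_smul_eq_self {t : Param p} {w : Fin m → ZMod p}
    (h0 : t.1 * w (e 2) + t.2.1 * w (e 3) = 0) (h1 : t.2.2 * w (e 2) = 0) :
    (mem e t : cornerGroup e) • w = w := by
  show (((mem e t : cornerGroup e) : GLm p m) : Mat p m) *ᵥ w = w
  rw [coe_mem, Matrix.add_mulVec, Matrix.one_mulVec, nil_mulVec, h0, h1, Pi.single_zero,
    Pi.single_zero, add_zero, add_zero]

/-- **Cover.**  Every vector is fixed by an element of `K_e` on which the bad character is `≠ 1`. -/
theorem cover (w : Fin m → ZMod p) :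
    ∃ k : cornerGroup (p := p) e, k • w = w ∧ badChar e k ≠ 1 := by
  by_cases hw : w (e 2) = 0
  · refine ⟨mem e (0, 0, 1), mem_smul_eq_self e ?_ ?_, badChar_mem_ne_one e (by simp)⟩
    · simp [hw]
    · simp [hw]
  · refine ⟨mem e (-(w (e 3)) * (w (e 2))⁻¹, 1, 0), mem_smul_eq_self e ?_ ?_,
      badChar_mem_ne_one e (by simp)⟩
    · simp only [one_mul]
      rw [mul_assoc, inv_mul_cancel₀ hw, mul_one, neg_add_cancel]
    · simp

/-- `K_e` carries no level-one delta. -/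
theorem false_of_delta {f : GLm p m → ℂ} (hf : f ∈ levelSubmodule p m 1) (h1 : f 1 = 1)
    (h0 : ∀ k : cornerGroup (p := p) e, (k : GLm p m) ≠ 1 → f k = 0) : False :=
  false_of_cover (cover e) hf h1 h0

end Group

section Crux

variable (e : Fin 4 ↪ Fin m)

/-- **No member contains a corner group** (from a level-one identity test on the triple: the
TPP and the character budget are not needed). -/
theorem corner_not_le_member_of_test {H₁ H₂ H₃ : Subgroup (GLm p m)} {f : GLm p m → ℂ}
    (hf : f ∈ levelSubmodule p m 1) (h1 : f 1 = 1)
    (h0 : ∀ a ∈ H₁, ∀ b ∈ H₂, ∀ c ∈ H₃, a * b * c ≠ 1 → f (a * b * c) = 0) :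
    ¬cornerGroup (p := p) e ≤ H₁ ∧ ¬cornerGroup (p := p) e ≤ H₂ ∧ ¬cornerGroup (p := p) e ≤ H₃ :=
  ⟨fun h => false_of_delta e hf h1 (vanish_of_le h0 (Or.inl h)),
    fun h => false_of_delta e hf h1 (vanish_of_le h0 (Or.inr (Or.inl h))),
    fun h => false_of_delta e hf h1 (vanish_of_le h0 (Or.inr (Or.inr h)))⟩

/-- **Crux form.**  In the notation of `SubgroupIdentityDesigns` at level `k = 1`: if the triple
`(H₁, H₂, H₃)` carries a level-one identity design, then no member contains the corner group `K_e`
of ANY embedding `e : Fin 4 ↪ Fin m` — for every prime `p`, every `m`, every exponent. -/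
theorem corner_not_le_member {H₁ H₂ H₃ : Subgroup (GLm p m)}
    (hdes : ∃ c : Mat p m → ℂ, (∀ M, 1 < M.rank → c M = 0) ∧
      (∑ M, c M * ZMod.stdAddChar (Matrix.trace (M * ((1 : GLm p m) : Mat p m)))) = 1 ∧
      ∀ a ∈ H₁, ∀ b ∈ H₂, ∀ g ∈ H₃, a * b * g ≠ 1 →
        (∑ M, c M * ZMod.stdAddChar (Matrix.trace (M * ((a * b * g : GLm p m) : Mat p m)))) = 0) :
    ¬cornerGroup (p := p) e ≤ H₁ ∧ ¬cornerGroup (p := p) e ≤ H₂ ∧ ¬cornerGroup (p := p) e ≤ H₃ := by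
  obtain ⟨f, hf, h1, h0⟩ := exists_test hdes
  exact corner_not_le_member_of_test e hf h1 h0

/-- Overgroups: no member contains any subgroup `K ⊇ K_e` (e.g. the full `2 × 2` corner, the
`2 × 2` block-unipotent radical, a parabolic). -/
theorem overgroup_not_le_member {H₁ H₂ H₃ : Subgroup (GLm p m)}
    (hdes : ∃ c : Mat p m → ℂ, (∀ M, 1 < M.rank → c M = 0) ∧
      (∑ M, c M * ZMod.stdAddChar (Matrix.trace (M * ((1 : GLm p m) : Mat p m)))) = 1 ∧
      ∀ a ∈ H₁, ∀ b ∈ H₂, ∀ g ∈ H₃, a * b * g ≠ 1 →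
        (∑ M, c M * ZMod.stdAddChar (Matrix.trace (M * ((a * b * g : GLm p m) : Mat p m)))) = 0)
    {K : Subgroup (GLm p m)} (hK : cornerGroup (p := p) e ≤ K) :
    ¬K ≤ H₁ ∧ ¬K ≤ H₂ ∧ ¬K ≤ H₃ := by
  obtain ⟨h₁, h₂, h₃⟩ := corner_not_le_member e hdes
  exact ⟨fun h => h₁ (hK.trans h), fun h => h₂ (hK.trans h), fun h => h₃ (hK.trans h)⟩

end Crux

end CornerGroupExclusion
end Summit.MatrixMultiplication.MatrixMultiplication.Theorems.SubgroupIdentityDesigns.Negative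

end
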